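import Summits.HodgeConjecture.HodgeConjecture.Theorems.HodgeProjectorDivisorSupportHodgeProjectorAlgebraicOrthogonalHodgeProjector
import Summits.HodgeConjecture.HodgeConjecture.Theorems.HodgeProjectorDivisorSupportHodgeProjectorAlgebraicGramKunnethClass
import Summits.HodgeConjecture.HodgeConjecture.Theses.HodgeProjectorDivisorSupport
import HarnessLib

/-!
# Crux `HodgeProjectorAlgebraic` (stmt-HodgeConjecture-18705) REDUCED to the algebraicity of the Gram–Künneth class

Route `HodgeConjecture/HodgeProjectorDivisorSupport`, crux W2; registered skeleton `Cruxes/HodgeProjectorAlgebraic/Lines/birth.lean`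
with the kernel-checked assembly `HodgeProjectorAlgebraic_of : Sig.stub_orthogonalHodgeProjector → Sig.stub_gramKunnethClass →
Sig.stub_gramClassAlgebraic → HodgeProjectorAlgebraic`. Stubs 1 and 2 are now THEOREMS
(`Theorems.HodgeProjectorAlgebraic.stub_orthogonalHodgeProjector`, `…stub_gramKunnethClass`); this file runs the assembly with
both discharged:

* **`hodgeProjectorAlgebraic_of_gramClassAlgebraic`**: the crux `Theses.HodgeProjectorDivisorSupport.HodgeProjectorAlgebraic` BY NAME
  from the single remaining registered stub `stub_gramClassAlgebraic` (its statement verbatim as the hypothesis): a rational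
  `(2n,2n)`-class `π₀` on `X ⊗ X` in the span of the exterior products of rational `(n,n)`-classes of `X`, acting by `t •` the
  identity on `Hdgⁿ(X)` and by `0` on its cup-orthogonal (`t ≠ 0`), is ALGEBRAIC — an instance of HC(`X × X`) in degree `4n`
  (implied by HC(`X`) in the middle degree), OPEN in general. Proof = the skeleton's: rescale the algebraic `π₀` by `t⁻¹`.

Nothing unconditional about the algebraicity of `π₀` is claimed; no definition, no named fact, no sorry.
References: [VoisinHodgeI2002] §11.3.3 Lemma 11.41; [BrosnanFangNiePearlstein2009] §6 (6.1); [Kleiman1968] §2.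
-/

noncomputable section

-- every declaration of this problem lives in `Summit.HodgeConjecture.HodgeConjecture.…` (summit = sub-problem)
set_option linter.dupNamespace false

open CategoryTheory AlgebraicGeometry MonoidalCategory CartesianMonoidalCategory
open Literature.AlgebraicGeometry.Motives Literature.AlgebraicGeometry.HodgeTheory
open Literature.AlgebraicTopology.SingularHomology

namespace Summit.HodgeConjecture.HodgeConjecture.Theorems.HodgeProjectorAlgebraic

/-- **Crux `HodgeProjectorAlgebraic` from the algebraicity of the Gram–Künneth class alone** (the skeleton's assembly
`HodgeProjectorAlgebraic_of` with stubs 1–2 discharged by `stub_orthogonalHodgeProjector` and `stub_gramKunnethClass`): if,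
for every smooth projective `X` of dimension `2n ≥ 2`, every rational `(2n,2n)`-class `π₀` on `X ⊗ X` in the span of the
exterior products of rational `(n,n)`-classes whose correspondence action is `t •` the identity on the rational
`(n,n)`-classes and `0` on their cup-orthogonal (`t ≠ 0`) is algebraic — the registered stub `stub_gramClassAlgebraic`,
verbatim — then `Summit.HodgeConjecture.HodgeConjecture.Theses.HodgeProjectorDivisorSupport.HodgeProjectorAlgebraic` holds:
`π := t⁻¹ • π₀` is the algebraic orthogonal Hodge projector. [cite: VoisinHodgeI2002, §11.3.3 Lemma 11.41]
[cite: BrosnanFangNiePearlstein2009, §6 display (6.1)] -/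
theorem hodgeProjectorAlgebraic_of_gramClassAlgebraic
    (h₃ : ∀ (n : ℕ) (X : SchemeOver ℂ) (hX : IsSmoothProjective (2 * n) X), 1 ≤ n →
      ∀ (π₀ : complexBetti (X ⊗ X) (2 * (2 * n))) (t : ℂ), t ≠ 0 →
        π₀ ∈ Submodule.span ℂ {v : complexBetti (X ⊗ X) (2 * (2 * n)) |
            ∃ a b : complexBetti X (2 * n), IsRationalClass a ∧ IsOfHodgeType (2 * n) X (2 * n) n n a ∧
              IsRationalClass b ∧ IsOfHodgeType (2 * n) X (2 * n) n n b ∧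
              v = cupProduct (two_mul (2 * n)).symm (complexBetti.map (fst X X) (2 * n) a)
                (complexBetti.map (snd X X) (2 * n) b)} →
        IsRationalClass π₀ →
        IsOfHodgeType (2 * n + 2 * n) (X ⊗ X) (2 * (2 * n)) (2 * n) (2 * n) π₀ →
        (∀ c : complexBetti X (2 * n), IsRationalClass c → IsOfHodgeType (2 * n) X (2 * n) n n c →
          corrAction complexOrientationFamily hX hX
            (rfl : 2 * n + 2 * (2 * n) = 2 * n + 2 * (2 * n)) π₀ c = t • c) →
        (∀ b : complexBetti X (2 * n),
          (∀ a : complexBetti X (2 * n), IsRationalClass a → IsOfHodgeType (2 * n) X (2 * n) n n a →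
            cupProduct (rfl : 2 * n + 2 * n = 2 * n + 2 * n) a b = 0) →
          corrAction complexOrientationFamily hX hX
            (rfl : 2 * n + 2 * (2 * n) = 2 * n + 2 * (2 * n)) π₀ b = 0) →
        π₀ ∈ algebraicClasses (X ⊗ X) (2 * n)) :
    Summit.HodgeConjecture.HodgeConjecture.Theses.HodgeProjectorDivisorSupport.HodgeProjectorAlgebraic := by
  intro n X hX hn
  obtain ⟨P, hPid, hPker⟩ := stub_orthogonalHodgeProjector n X hX hn
  obtain ⟨π₀, hspan, hrat, hhdg, t, ht, hact⟩ := stub_gramKunnethClass n X hX hn P hPid hPker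
  -- the action of `π₀`: `t •` identity on the rational `(n,n)`-classes, zero on their orthogonal
  have hid : ∀ c : complexBetti X (2 * n), IsRationalClass c →
      IsOfHodgeType (2 * n) X (2 * n) n n c →
        corrAction complexOrientationFamily hX hX
          (rfl : 2 * n + 2 * (2 * n) = 2 * n + 2 * (2 * n)) π₀ c = t • c := by
    intro c hc hh
    rw [hact, LinearMap.smul_apply, hPid c hc hh]
  have hker : ∀ b : complexBetti X (2 * n),
      (∀ a : complexBetti X (2 * n), IsRationalClass a → IsOfHodgeType (2 * n) X (2 * n) n n a →
        cupProduct (rfl : 2 * n + 2 * n = 2 * n + 2 * n) a b = 0) →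
        corrAction complexOrientationFamily hX hX
          (rfl : 2 * n + 2 * (2 * n) = 2 * n + 2 * (2 * n)) π₀ b = 0 := by
    intro b hb
    rw [hact, LinearMap.smul_apply, hPker b hb, smul_zero]
  -- stub 3 (hypothesis): `π₀` is algebraic; rescale by `t⁻¹`
  have halg : π₀ ∈ algebraicClasses (X ⊗ X) (2 * n) :=
    h₃ n X hX hn π₀ t ht hspan hrat hhdg hid hker
  refine ⟨t⁻¹ • π₀, Submodule.smul_mem _ _ halg, ?_, ?_⟩
  · intro c hc hh
    rw [map_smul, LinearMap.smul_apply, hid c hc hh, smul_smul, inv_mul_cancel₀ ht, one_smul]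
  · intro b hb
    rw [map_smul, LinearMap.smul_apply, hker b hb, smul_zero]

end Summit.HodgeConjecture.HodgeConjecture.Theorems.HodgeProjectorAlgebraic

end
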